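import Summits.ABC.IUTFork.Joshi.InitialThetaDataJoshiLemma321
import Summits.ABC.IUTFork.Joshi.InitialThetaDataJoshiTateRootProofs
import Literature.NumberTheory.EllipticCurves.GaloisConjugateReductionTypeProofs
import Literature.NumberTheory.EllipticCurves.TorsionRationalDescentProofs
import Literature.NumberTheory.EllipticCurves.AdditiveReductionRamifiedTorsionProofs
import HarnessLib

/-!
# [J-III] Lemma 3.2.1 (1) PROVED IN FULL for Joshi's typed data: the «only if» half, from (9) + (10)

Proof-only companion (theorems only; no definition, no named fact, no instance) of
`Summits/ABC/IUTFork/Joshi/InitialThetaDataJoshi.lean` (abc-iut-E-t6, p428841) and of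
`InitialThetaDataJoshiLemma321.lean` (p434506, the «if» half); cell abc-iut, block E «type Joshi's construction,
test vs S» (rung LADDER-ABC:A2.E), seat abc-iut-E-t6 (gen 2; DERIVABLE row of its own cluster, closing the reading
residual recorded by the second readers of p434506). TAKES NO SIDE on [IUTchIII] Cor. 3.12, on the claims of K. Joshi,
or on S. Mochizuki's reports on them; typed ≠ proved — except that the typed claim below IS now a kernel theorem
about Joshi's typed data `D : ATS3.InitialThetaData L L' Lbar C ℓ` ([J-III] §3.1 (1)–(4) + §3.3 (9)–(14); [J-III] =
K. Joshi, *Construction of Arithmetic Teichmüller Spaces III*, arXiv:2401.13508v4, «Preliminary version for comments»,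
UNREFEREED; render `HOME/lit/renders/Joshi-arxiv-2401.13508/pNNNN.txt`, «p.N l.M» = line M of page file N).

* `lemma321_holds : Lemma321 C` — **[J-III] Lemma 3.2.1 (1), p.27 l.31–34** «`w ∈ V^good_{L_mod}` if and only if
  `w | 2` or `X` has good reduction at `w` or has bad additive reduction at `w`» («immediate from the definitions»), in
  the typed ∀-READING of the statement file («`X` has … reduction at `w`» read at EVERY place of `L` over `w`, `X`
  living over `L`). The statement file flagged that under this reading the «only if» half is not a formal consequence
  of §3.2 (6)–(7) alone (places of `L` above one `w` might have mixed reduction types). THIS FILE shows that Joshi's own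
  hypotheses (9) «`L/L_mod` is Galois» and (10) «`L(C[6](L̄)) = L`» of §3.3 (p.28 l.1–4) EXCLUDE mixed types: the
  reduction type of `C/L` is CONSTANT on the places of `L` above any prime of `L_mod`
  (`hasGoodReductionAt_iff_of_liesOverMod`, `…Multiplicative…`, `…Additive…`), whence the «only if» half
  (`lemma321_onlyIf`) and, with p434506's `lemma321_iff_onlyIf`, the whole claim.

PROOF (classical; Silverman *AEC* VII.1/VII.5, X.2; Cassels–Fröhlich VII §1.1). For `σ ∈ Gal(L/L_mod)`: `j(C^σ) =
σ(j_C) = j_C` since `j_C ∈ L_mod = ℚ(j_C)`; by (10) every `3`-torsion point of `C(L̄)` is `L`-rational, and so is every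
`3`-torsion point of `C^σ(L̄)` (the nine `L`-rational `3`-torsion points of `C` pushed along `σ`, against `#C^σ[3] = 9`,
Silverman *AEC* III.6.4); hence `C^σ ≅_L C` by the twisting principle with rigidity of automorphisms on the `3`-torsion
([IUTchIV] Prop. 1.8 (iv) real form — the tree's `WeierstrassCurve.exists_variableChange_of_j_eq_of_torsion_fixed`,
abc-iut-L5-t12); so `C` has the same reduction type at `v` and `σ • v` (the tree's
`WeierstrassCurve.has…ReductionAt_iff_of_under_eq`, `GaloisConjugateReductionTypeProofs`), and `Gal(L/L_mod)` is
transitive on the places over `w` ((9)). Universe note: as in the sibling proofs files, `L L' Lbar : Type` (the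
tree's torsion-cardinality inputs are typed over `Type`). Inputs: Mathlib and LANDED tree theorems only, imported BY
NAME (DEFS-FREEZE respected; nothing of `InitialThetaDataJoshi.lean` restated); no new `Prop` fact, no `sorry`.
[claim: Joshi2024ATS3, status: disputed]

## References
* [Joshi2024ATS3] K. Joshi, arXiv:2401.13508v4, Lemma 3.2.1 p.27 l.31–37; §3.3 (9) (10) p.28 l.1–4.
* [SilvermanAEC2009] J. H. Silverman, *The Arithmetic of Elliptic Curves*, 2nd ed., GTM 106: Cor. III.6.4 (b), VII.1
  Prop. 1.3 (b), VII.5 Prop. 5.1, X.2 (twisting) with III.10.1.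
* [CasselsFrohlichANT1967] Cassels–Fröhlich (eds.), *Algebraic Number Theory*, Ch. VII §1.1, Prop. 1.2 (ii).
-/

noncomputable section

open scoped Classical
open NumberField IsDedekindDomain WeierstrassCurve
open Literature.IUT.HodgeTheaters hiding InitialThetaData

namespace Summit.ABC.IUTFork.Joshi.ATS3

/-! ## §1 The residue characteristic of a finite place is a prime -/

section ResidueChar

variable {F : Type*} [Field F] [NumberField F]

/-- The residue characteristic `p_w = char(𝓞_F/𝔭_w)` of a finite place ([IUTchI] §0 p.36, the tree's
`Literature.IUT.HodgeTheaters.residueChar`) is a prime number (`𝓞_F/𝔭_w` is a finite field). PROVED. [folklore] -/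
theorem residueChar_prime (w : FinitePlace F) : (residueChar w).Prime := by
  unfold residueChar
  haveI : w.maximalIdeal.asIdeal.IsMaximal := w.maximalIdeal.isMaximal
  letI : Field (𝓞 F ⧸ w.maximalIdeal.asIdeal) := Ideal.Quotient.field _
  haveI : Finite (𝓞 F ⧸ w.maximalIdeal.asIdeal) := Ideal.finiteQuotientOfFreeOfNeBot _ w.maximalIdeal.ne_bot
  haveI : CharP (𝓞 F ⧸ w.maximalIdeal.asIdeal) (ringChar (𝓞 F ⧸ w.maximalIdeal.asIdeal)) := ringChar.charP _
  rcases CharP.char_is_prime_or_zero (𝓞 F ⧸ w.maximalIdeal.asIdeal) (ringChar (𝓞 F ⧸ w.maximalIdeal.asIdeal))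
    with h | h
  · exact h
  · exact absurd h (CharP.ringChar_ne_zero_of_finite (𝓞 F ⧸ w.maximalIdeal.asIdeal))

/-- A finite place of residue characteristic `≠ 2` has ODD residue characteristic. PROVED. [folklore] -/
theorem odd_residueChar_of_ne_two (w : FinitePlace F) (hw : residueChar w ≠ 2) : Odd (residueChar w) :=
  (residueChar_prime w).odd_of_ne_two hw

end ResidueChar

/-! ## §2 For Joshi's data: `C^σ ≅_L C` for every `σ ∈ Gal(L/L_mod)` -/

namespace InitialThetaData

variable {L L' Lbar : Type} [Field L] [NumberField L] [Field L'] [NumberField L'] [Algebra L L'] [Field Lbar]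
  [Algebra L Lbar] [Algebra L' Lbar] {C : WeierstrassCurve L} [C.IsElliptic] {ℓ : ℕ}
  (D : InitialThetaData L L' Lbar C ℓ)

/-- `v` lies over `w` (the statement file's `LiesOverMod`, restriction of places) iff the prime of `v` contracts to the
prime of `w` in `𝓞_{L_mod}` (Mathlib's `HeightOneSpectrum.under`). PROVED. [folklore] -/
theorem liesOverMod_iff_under_eq (v : FinitePlace L) (w : FinitePlace (fieldOfModuli C)) :
    LiesOverMod C v w ↔ v.maximalIdeal.under (𝓞 (fieldOfModuli C)) = w.maximalIdeal := by
  unfold LiesOverMod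
  change Val.non (FinitePlace.mk (v.maximalIdeal.under (𝓞 (fieldOfModuli C)))) = Val.non w ↔ _
  constructor
  · intro h
    have h' : FinitePlace.mk (v.maximalIdeal.under (𝓞 (fieldOfModuli C))) = w := Sum.inr_injective h
    rw [← h', FinitePlace.maximalIdeal_mk]
  · intro h
    rw [h, FinitePlace.mk_maximalIdeal]

include D

/-- **(10) ⇒ `Aut(L̄/L)` fixes `C[3]`**: every point of `C(L̄)` killed by `3` is killed by `6`, hence `L`-rational by
**[J-III] §3.3 (10), p.28 l.4** «`L(C[6](L̄)) = L`» (`torsion_six_rational`), hence fixed by every `τ ∈ Aut(L̄/L)`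
(Mathlib `Affine.Point.map_baseChange`). PROVED. [claim: Joshi2024ATS3, status: disputed] -/
theorem map_algEquiv_eq_self_of_three_torsion (τ : Lbar ≃ₐ[L] Lbar) (T : (C.baseChange Lbar).toAffine.Point)
    (hT : ((3 : ℕ) : ℤ) • T = 0) : Affine.Point.map (τ : Lbar →ₐ[L] Lbar) T = T := by
  have h6 : (6 : ℤ) • T = 0 := by
    rw [show (6 : ℤ) = 2 * ((3 : ℕ) : ℤ) by norm_num, mul_zsmul, hT, zsmul_zero]
  obtain ⟨P, hP⟩ := D.torsion_six_rational T h6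
  rw [← hP]
  exact Affine.Point.map_baseChange _ P

/-- **All of `C^σ[3]` is `L`-rational, for `σ ∈ Gal(L/L_mod)`**: the nine `L`-rational points of `C` killed by `3`
((10); E-t63's `exists_finset_three_torsion`) pushed along `σ` (the tree's `exists_pointHom_map`: `(x, y) ↦ (σ x, σ y)`,
Silverman *AEC* III.2.3) are nine `L`-rational points of `C^σ(L̄)` killed by `3`, and `#C^σ(L̄)[3] = 9` (Silverman
*AEC* III.6.4 (b), the tree's `card_torsionPoints_eq_sq_holds`); so every `3`-torsion point of `C^σ(L̄)` is
`L`-rational, hence fixed by `Aut(L̄/L)`. PROVED. [claim: Joshi2024ATS3, status: disputed]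
[cite: SilvermanAEC2009, Cor. III.6.4(b)] -/
theorem map_algEquiv_eq_self_of_three_torsion_conj (σ : L ≃ₐ[fieldOfModuli C] L) (τ : Lbar ≃ₐ[L] Lbar)
    (T : ((C.map (σ : L →+* L)).baseChange Lbar).toAffine.Point) (hT : ((3 : ℕ) : ℤ) • T = 0) :
    Affine.Point.map (τ : Lbar →ₐ[L] Lbar) T = T := by
  haveI := D.isAlgClosure
  haveI : IsAlgClosed Lbar := IsAlgClosure.isAlgClosed L
  haveI : CharZero Lbar := charZero_of_injective_algebraMap (algebraMap L Lbar).injective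
  -- nine `L`-points of `C` killed by `3` (E-t63's finset, re-read on `C.toAffine.Point`, the same type up to `C ⊗_L L = C`)
  obtain ⟨S, hS9, hS3⟩ : ∃ S : Finset C.toAffine.Point, S.card = 9 ∧ ∀ P ∈ S, (3 : ℕ) • P = 0 :=
    D.exists_finset_three_torsion
  -- transport along `σ`: `C(L) → C^σ(L)`, then base change `C^σ(L) → C^σ(L̄)`
  obtain ⟨f, hf⟩ := WeierstrassCurve.exists_pointHom_map C (σ : L →+* L)
  have hfinj : Function.Injective f := by
    intro P Q h
    rcases P with _ | ⟨x₁, y₁, h₁⟩ <;> rcases Q with _ | ⟨x₂, y₂, h₂⟩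
    · rfl
    · change f 0 = f (.some x₂ y₂ h₂) at h
      rw [map_zero, hf] at h
      exact absurd h.symm (Affine.Point.some_ne_zero _)
    · change f (.some x₁ y₁ h₁) = f 0 at h
      rw [map_zero, hf] at h
      exact absurd h (Affine.Point.some_ne_zero _)
    · rw [hf, hf, Affine.Point.some.injEq] at h
      obtain ⟨hx, hy⟩ := h
      have hx' : x₁ = x₂ := (σ : L →+* L).injective hx
      have hy' : y₁ = y₂ := (σ : L →+* L).injective hy
      subst hx' hy'
      rfl
  set g : (C.map (σ : L →+* L)).toAffine.Point →+ ((C.map (σ : L →+* L)).baseChange Lbar).toAffine.Point :=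
    Affine.Point.baseChange (W' := (C.map (σ : L →+* L)).toAffine) L Lbar with hg
  have hginj : Function.Injective g := Affine.Point.map_injective _
  let e : C.toAffine.Point → ((C.map (σ : L →+* L)).baseChange Lbar).toAffine.Point := fun P => g (f P)
  have heinj : Function.Injective e := fun P Q h => hfinj (hginj h)
  set T₉ : Finset ((C.map (σ : L →+* L)).baseChange Lbar).toAffine.Point := S.image e with hT₉
  have hT₉card : T₉.card = 9 := by rw [hT₉, Finset.card_image_of_injective S heinj, hS9]
  -- the geometric `3`-torsion of `C^σ`: `9` points
  set Tset : Set ((C.map (σ : L →+* L)).baseChange Lbar).toAffine.Point :=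
    SetLike.coe (torsionPoints (C.map (σ : L →+* L)) Lbar ((3 : ℕ) : ℤ)) with hTset
  have h9 : Tset.ncard = 9 := by
    rw [hTset, ← Nat.card_coe_set_eq]
    exact card_torsionPoints_eq_sq_holds (C.map (σ : L →+* L)) Lbar (n := 3) (by norm_num)
  have hsub : (↑T₉ : Set _) ⊆ Tset := by
    intro Q hQ
    obtain ⟨P, hP, rfl⟩ := Finset.mem_image.mp (Finset.mem_coe.mp hQ)
    show g (f P) ∈ torsionPoints (C.map (σ : L →+* L)) Lbar ((3 : ℕ) : ℤ)
    rw [mem_torsionPoints_iff, natCast_zsmul, ← map_nsmul, ← map_nsmul, hS3 P hP, map_zero, map_zero]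
  have hfin : Tset.Finite := Set.finite_of_ncard_ne_zero (by rw [h9]; norm_num)
  have heq : (↑T₉ : Set _) = Tset :=
    Set.eq_of_subset_of_ncard_le hsub (by rw [h9, Set.ncard_coe_finset, hT₉card]) hfin
  have hTmem : T ∈ Tset := by
    show T ∈ torsionPoints (C.map (σ : L →+* L)) Lbar ((3 : ℕ) : ℤ)
    exact (mem_torsionPoints_iff _ _ T).mpr hT
  rw [← heq] at hTmem
  obtain ⟨P, -, rfl⟩ := Finset.mem_image.mp (Finset.mem_coe.mp hTmem)
  exact Affine.Point.map_baseChange (W' := (C.map (σ : L →+* L)).toAffine) (F := L) (K := Lbar) (L := Lbar) τ (f P)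

/-- **`C^σ ≅_L C` for every `σ ∈ Gal(L/L_mod)`** (change of variables over `L` with `C₀ • C = C^σ`): `j(C^σ) = σ(j_C) =
j_C` (`j_C ∈ L_mod = ℚ(j_C)`, the tree's `fieldOfModuli`, [J-III] §3.1 (4) / [IUTchI] Def. 3.1 (b)), and both `C[3]` and
`C^σ[3]` are `L`-rational ((10)); [IUTchIV] Prop. 1.8 (iv) in real form (Silverman *AEC* X.2 twisting + III.10.1
rigidity on `3`-torsion; the tree's `WeierstrassCurve.exists_variableChange_of_j_eq_of_torsion_fixed`, abc-iut-L5-t12)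
with `l = 3` over the algebraic closure `L̄`. PROVED. [claim: Joshi2024ATS3, status: disputed]
[cite: SilvermanAEC2009, X.2 and III.10 Thm. 10.1] -/
theorem exists_variableChange_eq_map_algEquiv (σ : L ≃ₐ[fieldOfModuli C] L) :
    ∃ C₀ : VariableChange L, C₀ • C = C.map (σ : L →+* L) := by
  haveI := D.isAlgClosure
  haveI : IsAlgClosed Lbar := IsAlgClosure.isAlgClosed L
  haveI : CharZero Lbar := charZero_of_injective_algebraMap (algebraMap L Lbar).injective
  haveI : Algebra.IsAlgebraic L Lbar := IsAlgClosure.isAlgebraic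
  haveI : IsGalois L Lbar := {}
  have hj : C.j = (C.map (σ : L →+* L)).j := by
    rw [WeierstrassCurve.map_j]
    exact (σ.commutes ⟨C.j, IntermediateField.mem_adjoin_simple_self ℚ C.j⟩).symm
  exact WeierstrassCurve.exists_variableChange_of_j_eq_of_torsion_fixed (L := Lbar) C (C.map (σ : L →+* L)) hj
    two_ne_zero three_ne_zero Nat.prime_three le_rfl (by norm_num)
    (fun τ T hT => D.map_algEquiv_eq_self_of_three_torsion τ T hT)
    (fun τ T hT => D.map_algEquiv_eq_self_of_three_torsion_conj σ τ T hT)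

/-! ## §3 The reduction type of `C/L` is constant above every prime of `L_mod` -/

/-- **Good reduction is constant above a prime of `L_mod`**: for Joshi's data, if `v, v'` are places of `L` over the
same prime `w` of `L_mod`, then `C` has good reduction at `v` iff at `v'` ((9): `Gal(L/L_mod)` permutes the places over
`w` transitively; `C^σ ≅_L C`; a conjugate curve has the conjugate reduction type — the tree's
`WeierstrassCurve.hasGoodReductionAt_iff_of_under_eq`). PROVED. [claim: Joshi2024ATS3, status: disputed]
[cite: SilvermanAEC2009, VII.5 Prop. 5.1] -/
theorem hasGoodReductionAt_iff_of_liesOverMod {v v' : FinitePlace L} {w : FinitePlace (fieldOfModuli C)}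
    (hv : LiesOverMod C v w) (hv' : LiesOverMod C v' w) :
    C.HasGoodReductionAt v.maximalIdeal ↔ C.HasGoodReductionAt v'.maximalIdeal := by
  haveI := D.isGalois_fieldOfModuli
  exact WeierstrassCurve.hasGoodReductionAt_iff_of_under_eq (F := fieldOfModuli C) C
    D.exists_variableChange_eq_map_algEquiv
    (((liesOverMod_iff_under_eq v w).mp hv).trans ((liesOverMod_iff_under_eq v' w).mp hv').symm)

/-- **Multiplicative reduction is constant above a prime of `L_mod`** (same argument). PROVED.
[claim: Joshi2024ATS3, status: disputed] [cite: SilvermanAEC2009, VII.5 Prop. 5.1(b)] -/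
theorem hasMultiplicativeReductionAt_iff_of_liesOverMod {v v' : FinitePlace L} {w : FinitePlace (fieldOfModuli C)}
    (hv : LiesOverMod C v w) (hv' : LiesOverMod C v' w) :
    C.HasMultiplicativeReductionAt v.maximalIdeal ↔ C.HasMultiplicativeReductionAt v'.maximalIdeal := by
  haveI := D.isGalois_fieldOfModuli
  exact WeierstrassCurve.hasMultiplicativeReductionAt_iff_of_under_eq (F := fieldOfModuli C) C
    D.exists_variableChange_eq_map_algEquiv
    (((liesOverMod_iff_under_eq v w).mp hv).trans ((liesOverMod_iff_under_eq v' w).mp hv').symm)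

/-- **Additive reduction is constant above a prime of `L_mod`** (same argument). PROVED.
[claim: Joshi2024ATS3, status: disputed] [cite: SilvermanAEC2009, VII.5 Prop. 5.1(c)] -/
theorem hasAdditiveReductionAt_iff_of_liesOverMod {v v' : FinitePlace L} {w : FinitePlace (fieldOfModuli C)}
    (hv : LiesOverMod C v w) (hv' : LiesOverMod C v' w) :
    C.HasAdditiveReductionAt v.maximalIdeal ↔ C.HasAdditiveReductionAt v'.maximalIdeal := by
  haveI := D.isGalois_fieldOfModuli
  exact WeierstrassCurve.hasAdditiveReductionAt_iff_of_under_eq (F := fieldOfModuli C) C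
    D.exists_variableChange_eq_map_algEquiv
    (((liesOverMod_iff_under_eq v w).mp hv).trans ((liesOverMod_iff_under_eq v' w).mp hv').symm)

/-! ## §4 [J-III] Lemma 3.2.1 (1): the «only if» half and the whole claim -/

/-- **[J-III] Lemma 3.2.1 (1), «only if» half, p.27 l.31–34**, in the typed ∀-reading: if `w ∈ V^good_{L_mod}` then
`w | 2`, or `X` has good reduction at every place of `L` over `w`, or additive reduction at every place of `L` over `w`.
(`w ∉ V^{odd,ss}_{L_mod}` with `p_w` odd gives a place `v₀ | w` of non-multiplicative — good or additive — reduction,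
local trichotomy; by §3 every place over `w` then has that same type.) PROVED. [claim: Joshi2024ATS3, status: disputed] -/
theorem lemma321_onlyIf (w : FinitePlace (fieldOfModuli C)) (hw : w ∈ VgoodMod C) :
    residueChar w = 2 ∨ (∀ v : FinitePlace L, LiesOverMod C v w → C.HasGoodReductionAt v.maximalIdeal) ∨
      (∀ v : FinitePlace L, LiesOverMod C v w → C.HasAdditiveReductionAt v.maximalIdeal) := by
  by_cases h2 : residueChar w = 2
  · exact Or.inl h2
  right
  have hodd : Odd (residueChar w) := odd_residueChar_of_ne_two w h2
  rw [mem_vgoodMod_iff] at hw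
  have hex : ∃ v₀ : FinitePlace L, LiesOverMod C v₀ w ∧ ¬ C.HasMultiplicativeReductionAt v₀.maximalIdeal := by
    by_contra hne
    exact hw ⟨hodd, fun v hv => by_contra fun hm => hne ⟨v, hv, hm⟩⟩
  obtain ⟨v₀, hv₀, hnm⟩ := hex
  rcases C.hasGoodReductionAt_or_hasMultiplicativeReductionAt_or_hasAdditiveReductionAt v₀.maximalIdeal with
    hg | hm | ha
  · exact Or.inl fun v hv => (D.hasGoodReductionAt_iff_of_liesOverMod hv hv₀).mpr hg
  · exact absurd hm hnm
  · exact Or.inr fun v hv => (D.hasAdditiveReductionAt_iff_of_liesOverMod hv hv₀).mpr ha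

/-- **[J-III] Lemma 3.2.1 DISCHARGED for Joshi's typed data**: the claim `ATS3.Lemma321 C` of the statement file
(Lemma 3.2.1 (1), p.27 l.31–34, typed ∀-reading; (2) of the lemma asserts nothing beyond `mem_vgoodMod_of_residueChar_two`)
HOLDS for every `D : InitialThetaData L L' Lbar C ℓ` — the «if» half is p434506's `lemma321_if`, the «only if» half is
`lemma321_onlyIf` (from (9) and (10)). The READING FLAG of the statement file on the «only if» half thus dissolves under
Joshi's own §3.3 hypotheses. PROVED. [claim: Joshi2024ATS3, status: disputed] -/
theorem lemma321_holds : Lemma321 C :=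
  (lemma321_iff_onlyIf C).mpr fun w hw => D.lemma321_onlyIf w hw

/-! ## §5 (v2 append) Two corollaries: the ∀/∃ readings of §3.2 (6) coincide; semistability away from `3` -/

/-- **The reading flag on [J-III] §3.2 (6), p.27 l.23–25, ∀ versus ∃, dissolves under (9)+(10)**: «the set of primes of
`L_mod` … at which `X` has bad, semi-stable reduction» was typed with multiplicative reduction at EVERY place of `L` over
the prime (`VoddssMod`); for Joshi's data this is the same as multiplicative reduction at SOME place of `L` over it
(constancy, `hasMultiplicativeReductionAt_iff_of_liesOverMod`; a place over `w` exists, p434506's `exists_liesOverMod`).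
PROVED. [claim: Joshi2024ATS3, status: disputed] -/
theorem mem_voddssMod_iff_exists (w : FinitePlace (fieldOfModuli C)) :
    w ∈ VoddssMod C ↔ Odd (residueChar w) ∧
      ∃ v : FinitePlace L, LiesOverMod C v w ∧ C.HasMultiplicativeReductionAt v.maximalIdeal := by
  constructor
  · rintro ⟨hodd, hall⟩
    obtain ⟨v, hv⟩ := exists_liesOverMod C w
    exact ⟨hodd, v, hv, hall v hv⟩
  · rintro ⟨hodd, v₀, hv₀, hm⟩
    exact ⟨hodd, fun v hv => (D.hasMultiplicativeReductionAt_iff_of_liesOverMod hv hv₀).mpr hm⟩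

/-- Dually for **§3.2 (7) `V^good_{L_mod}`**: `w ∈ V^good_{L_mod}` iff `p_w = 2` or `C` has NON-multiplicative (good or
additive) reduction at SOME (equivalently, by constancy, at every) place of `L` over `w`. PROVED.
[claim: Joshi2024ATS3, status: disputed] -/
theorem mem_vgoodMod_iff_exists (w : FinitePlace (fieldOfModuli C)) :
    w ∈ VgoodMod C ↔ residueChar w = 2 ∨
      ∃ v : FinitePlace L, LiesOverMod C v w ∧ ¬ C.HasMultiplicativeReductionAt v.maximalIdeal := by
  show w ∉ VoddssMod C ↔ _
  rw [D.mem_voddssMod_iff_exists, not_and_or]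
  constructor
  · rintro (hodd | hne)
    · left
      by_contra h2
      exact hodd (odd_residueChar_of_ne_two w h2)
    · right
      obtain ⟨v, hv⟩ := exists_liesOverMod C w
      exact ⟨v, hv, fun hm => hne ⟨v, hv, hm⟩⟩
  · rintro (h2 | ⟨v₀, hv₀, hnm⟩)
    · left
      rw [h2]
      exact Nat.not_odd_iff_even.mpr even_two
    · right
      rintro ⟨v, hv, hm⟩
      exact hnm ((D.hasMultiplicativeReductionAt_iff_of_liesOverMod hv₀ hv).mpr hm)

/-- **(10) ⇒ `Γ_L` acts trivially on the geometric `3`-torsion `C[3] = C(L^alg)[3]`** (the tree's `geomTorsion` over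
Mathlib's `AlgebraicClosure L`, transported from the given algebraic closure `L̄` of (3) along `L̄ ≃_L L^alg`,
`IsAlgClosure.equiv`): a `3`-torsion point is killed by `6`, hence `L`-rational by (10), hence `Γ_L`-fixed. PROVED.
[claim: Joshi2024ATS3, status: disputed] -/
theorem smul_geomTorsion_three_eq_self (σ : Field.absoluteGaloisGroup L)
    (Q : WeierstrassCurve.geomTorsion C ((3 : ℕ) : ℤ)) : σ • Q = Q := by
  haveI := D.isAlgClosure
  obtain ⟨P, hPmem⟩ := Q
  apply Subtype.ext
  rw [Literature.NumberTheory.EllipticCurves.AddSubgroup.torsionBy.coe_smul]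
  have hP3 : ((3 : ℕ) : ℤ) • (show (C.baseChange (AlgebraicClosure L)).toAffine.Point from P) = 0 :=
    (Submodule.mem_torsionBy_iff _ _).mp hPmem
  -- transfer to the given algebraic closure `Lbar`
  let e : Lbar ≃ₐ[L] AlgebraicClosure L := IsAlgClosure.equiv L Lbar (AlgebraicClosure L)
  set Q' : (C.baseChange Lbar).toAffine.Point :=
    Affine.Point.map (W' := C.toAffine) (e.symm : AlgebraicClosure L →ₐ[L] Lbar) P with hQ'
  have h3' : ((3 : ℕ) : ℤ) • Q' = 0 := by
    rw [hQ', ← map_zsmul]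
    exact (congrArg _ hP3).trans (map_zero _)
  have h6 : (6 : ℤ) • Q' = 0 := by
    rw [show (6 : ℤ) = 2 * ((3 : ℕ) : ℤ) by norm_num, mul_zsmul, h3', zsmul_zero]
  obtain ⟨P₀, hP₀⟩ := D.torsion_six_rational Q' h6
  have hid : ∀ R : (C.baseChange (AlgebraicClosure L)).toAffine.Point,
      Affine.Point.map (W' := C.toAffine) (AlgHom.id L (AlgebraicClosure L)) R = R := by
    intro R
    cases R <;> rfl
  have hPQ : (show (C.baseChange (AlgebraicClosure L)).toAffine.Point from P) =
      Affine.Point.map (W' := C.toAffine) (e : Lbar →ₐ[L] AlgebraicClosure L) Q' := by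
    rw [hQ', Affine.Point.map_map, AlgEquiv.comp_symm, hid]
  show Affine.Point.map (W' := C.toAffine)
      ((show AlgebraicClosure L ≃ₐ[L] AlgebraicClosure L from σ) : AlgebraicClosure L →ₐ[L] AlgebraicClosure L)
      P = P
  rw [hPQ, ← hP₀, Affine.Point.map_baseChange, Affine.Point.map_baseChange]

/-- **[IUTchI] Def. 3.1 (b) «`E_F` has stable reduction at every nonarchimedean place», which Joshi's §3 OMITS, is
AUTOMATIC for Joshi's data at every place `v ∤ 3`**: `C[3] ⊂ C(L)` by (10), and an elliptic curve with rational `3`-torsion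
is semistable away from `3` ([IUTchIV] Prop. 1.8 (v) / Raynaud; Silverman *AEC* VII.7.1 — the tree's
`WeierstrassCurve.isSemistableAt_of_forall_smul_geomTorsion_eq`, PROVED there). At places over `3` nothing is claimed
(so `InitialThetaData.ofMochizuki` still has no converse). PROVED. [claim: Joshi2024ATS3, status: disputed]
[cite: SilvermanAEC2009, Thm. VII.6.1 and proof of Thm. VII.7.1] -/
theorem isSemistableAt_of_three_not_mem (v : HeightOneSpectrum (𝓞 L)) (hv : ((3 : ℕ) : 𝓞 L) ∉ v.asIdeal) :
    C.IsSemistableAt v :=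
  C.isSemistableAt_of_forall_smul_geomTorsion_eq Nat.prime_three le_rfl D.smul_geomTorsion_three_eq_self v hv

/-- Hence, above a prime `w` of `L_mod` not over `3`, Lemma 3.2.1 (1) sharpens to: `w ∈ V^good_{L_mod}` iff `p_w = 2` or
`C` has GOOD reduction at every place of `L` over `w` (no additive places away from `3`). PROVED.
[claim: Joshi2024ATS3, status: disputed] -/
theorem mem_vgoodMod_iff_good_of_three_not_mem (w : FinitePlace (fieldOfModuli C))
    (h3 : ∀ v : FinitePlace L, LiesOverMod C v w → ((3 : ℕ) : 𝓞 L) ∉ v.maximalIdeal.asIdeal) :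
    w ∈ VgoodMod C ↔ residueChar w = 2 ∨
      ∀ v : FinitePlace L, LiesOverMod C v w → C.HasGoodReductionAt v.maximalIdeal := by
  constructor
  · intro hw
    rcases D.lemma321_onlyIf w hw with h2 | hg | ha
    · exact Or.inl h2
    · exact Or.inr hg
    · obtain ⟨v, hv⟩ := exists_liesOverMod C w
      exact absurd (ha v hv) ((C.isSemistableAt_iff_not_hasAdditiveReductionAt v.maximalIdeal).mp
        (D.isSemistableAt_of_three_not_mem v.maximalIdeal (h3 v hv)))
  · rintro (h2 | hg)
    · exact mem_vgoodMod_of_residueChar_two C w h2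
    · exact lemma321_if C w (Or.inr (Or.inl hg))

end InitialThetaData

end Summit.ABC.IUTFork.Joshi.ATS3

end
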